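import Literature.Geometry.Lorentzian.AsymptoticFlatnessProofs
import HarnessLib

/-!
# Decay at infinity under dilation of the chart: `(M, β, γ, nh, nk) ↦ (cM, β, γ, nh, nk)`

Analytic support file (topic `Geometry/Lorentzian`; everything PROVED). The chart components of a
DILATED asymptotically flat datum — a body rescaled by `c > 0`, or the same datum read in the chart
`c • chart` — are those of the original datum composed with `ζ ↦ c⁻¹ ζ` (and, for `k`, multiplied
by the constant `c⁻¹`). This file isolates the bookkeeping showing that the decay classes
`AFEnd.IsStronglyAsymptoticallyFlatWith e D M β γ nh nk` are stable under this operation with the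
mass parameter multiplied by `c` (the ADM mass scales like a length; Bartnik 1986, (4.2)):

* `dilationEquiv c` — `y ↦ c • y` as a continuous linear equivalence of `ℝ³`;
  `norm_dilationEquiv_le`, `tendsto_dilation_cobounded`;
* `norm_iteratedFDeriv_le_of_eqOn_dilation` — if `G = F ∘ (c •)` beyond a sphere then
  `‖∂ᵐG(y)‖ ≤ |c|ᵐ ‖∂ᵐF(c y)‖` there; `isLittleO_iteratedFDeriv_of_eqOn_dilation` — hence
  `∂ᵐF = o(rᵖ)` at infinity implies `∂ᵐG = o(rᵖ)`; `isLittleO_iteratedFDeriv_const_smul`;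
* `AFEnd.IsStronglyAsymptoticallyFlatWith.of_coeff_dilation` — **the transfer theorem**: if two
  ends `e` (of `X`) and `e'` (of `X'`) and data `D`, `D'` satisfy, beyond some sphere,
  `hCoeff e' D' ζ = hCoeff e D (c⁻¹ ζ)` and `kCoeff e' D' ζ = c⁻¹ • kCoeff e D (c⁻¹ ζ)`, then
  `D` of class `(M, β, γ, nh, nk)` along `e` implies `D'` of class `(cM, β, γ, nh, nk)` along `e'`
  (since `1 + 2(cM)/‖ζ‖ = 1 + 2M/‖c⁻¹ζ‖`); `…DR.of_coeff_dilation` the Dafermos–Rodnianski case.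

Used by `AFEndDilate.lean` (same datum, dilated chart, homothetic data) and
`AFEndTransplantCoeff.lean` (rescaled transplanted bodies).

## References

* R. Bartnik, *The mass of an asymptotically flat manifold*, CPAM 39 (1986), §1, (4.2). [Bartnik1986]
* M. Dafermos, I. Rodnianski, *Lectures on black holes and linear waves* (2013), App. B.2.3.
  [DafermosRodnianski2013]
-/

noncomputable section

open Set Filter Bornology Asymptotics
open scoped Manifold ContDiff Topology

namespace Literature.Geometry.Lorentzian

/-! ### Decay of a dilated function: an analytic lemma on `ℝ³` -/

section Dilation

variable {V : Type*} [NormedAddCommGroup V] [NormedSpace ℝ V]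

/-- The dilation `y ↦ c • y` of `ℝ³` as a continuous linear equivalence (`c ≠ 0`). [folklore] -/
def dilationEquiv (c : ℝ) (hc : c ≠ 0) : E3 ≃L[ℝ] E3 :=
  ContinuousLinearEquiv.equivOfInverse (c • ContinuousLinearMap.id ℝ E3) (c⁻¹ • ContinuousLinearMap.id ℝ E3)
    (fun y ↦ by
      simp only [FunLike.coe_smul, Pi.smul_apply, ContinuousLinearMap.coe_id', id_eq]
      exact inv_smul_smul₀ hc y)
    (fun y ↦ by
      simp only [FunLike.coe_smul, Pi.smul_apply, ContinuousLinearMap.coe_id', id_eq]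
      exact smul_inv_smul₀ hc y)

/-- `dilationEquiv c hc y = c • y`. [folklore] -/
@[simp] theorem dilationEquiv_apply (c : ℝ) (hc : c ≠ 0) (y : E3) : dilationEquiv c hc y = c • y := rfl

/-- The operator norm of the dilation is at most `|c|`. [folklore] -/
theorem norm_dilationEquiv_le (c : ℝ) (hc : c ≠ 0) : ‖(dilationEquiv c hc : E3 →L[ℝ] E3)‖ ≤ |c| := by
  refine ContinuousLinearMap.opNorm_le_bound _ (abs_nonneg c) fun y ↦ ?_
  show ‖dilationEquiv c hc y‖ ≤ |c| * ‖y‖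
  rw [dilationEquiv_apply, norm_smul, Real.norm_eq_abs]

/-- The dilation tends to infinity along `cobounded`. [folklore] -/
theorem tendsto_dilation_cobounded (c : ℝ) (hc : c ≠ 0) :
    Tendsto (fun y : E3 ↦ c • y) (cobounded E3) (cobounded E3) := by
  rw [← tendsto_norm_atTop_iff_cobounded]
  have h : (fun y : E3 ↦ ‖c • y‖) = fun y ↦ |c| * ‖y‖ := by
    funext y; rw [norm_smul, Real.norm_eq_abs]
  rw [h]
  exact tendsto_norm_cobounded_atTop.const_mul_atTop (abs_pos.2 hc)

/-- **Iterated derivatives of a dilated function**: if `G y = F (c • y)` for `‖y‖ > R₀` (`c ≠ 0`)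
then `‖∂ᵐ G (y)‖ ≤ |c|ᵐ ‖∂ᵐ F (c • y)‖` there (`iteratedFDeriv` of a composition with a linear
equivalence, no differentiability needed). [folklore] -/
theorem norm_iteratedFDeriv_le_of_eqOn_dilation {F G : E3 → V} {c R₀ : ℝ} (hc : c ≠ 0)
    (hFG : ∀ y : E3, R₀ < ‖y‖ → G y = F (c • y)) (m : ℕ) {y : E3} (hy : R₀ < ‖y‖) :
    ‖iteratedFDeriv ℝ m G y‖ ≤ |c| ^ m * ‖iteratedFDeriv ℝ m F (c • y)‖ := by
  -- `G = F ∘ g` near `y`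
  have hev : G =ᶠ[𝓝 y] (F ∘ dilationEquiv c hc) := by
    filter_upwards [(isOpen_lt continuous_const continuous_norm).mem_nhds hy] with z hz
    rw [Function.comp_apply, dilationEquiv_apply, hFG z hz]
  rw [(hev.iteratedFDeriv ℝ m).eq_of_nhds]
  -- composition with a linear equivalence on the right
  have hcomp := (dilationEquiv c hc).iteratedFDerivWithin_comp_right F uniqueDiffOn_univ
    (x := y) (Set.mem_univ _) m
  rw [Set.preimage_univ, iteratedFDerivWithin_univ, iteratedFDerivWithin_univ] at hcomp
  rw [hcomp, dilationEquiv_apply]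
  refine (ContinuousMultilinearMap.norm_compContinuousLinearMap_le _ _).trans ?_
  rw [Finset.prod_const, Finset.card_univ, Fintype.card_fin, mul_comm]
  exact mul_le_mul_of_nonneg_right (pow_le_pow_left₀ (norm_nonneg _) (norm_dilationEquiv_le c hc) m)
    (norm_nonneg _)

/-- **Decay at infinity of a dilated function**: if `G y = F (c • y)` for `‖y‖ > R₀` (`c ≠ 0`) and
`‖∂ᵐF(y)‖ = o(‖y‖ᵖ)` at infinity, then `‖∂ᵐG(y)‖ = o(‖y‖ᵖ)` at infinity (all constants are absorbed
by the little-`o`). [folklore] -/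
theorem isLittleO_iteratedFDeriv_of_eqOn_dilation {F G : E3 → V} {c R₀ p : ℝ} (hc : c ≠ 0)
    (hFG : ∀ y : E3, R₀ < ‖y‖ → G y = F (c • y)) (m : ℕ)
    (hF : (fun y ↦ ‖iteratedFDeriv ℝ m F y‖) =o[cobounded E3] fun y ↦ ‖y‖ ^ p) :
    (fun y ↦ ‖iteratedFDeriv ℝ m G y‖) =o[cobounded E3] fun y ↦ ‖y‖ ^ p := by
  -- `‖∂ᵐG‖ = O(‖∂ᵐF ∘ (c •)‖)`
  have h1 : (fun y ↦ ‖iteratedFDeriv ℝ m G y‖) =O[cobounded E3]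
      fun y ↦ ‖iteratedFDeriv ℝ m F (c • y)‖ := by
    refine IsBigO.of_bound (|c| ^ m) ?_
    filter_upwards [eventually_cobounded_le_norm (E := E3) (R₀ + 1)] with y hy
    rw [Real.norm_of_nonneg (norm_nonneg _), Real.norm_of_nonneg (norm_nonneg _)]
    exact norm_iteratedFDeriv_le_of_eqOn_dilation hc hFG m (by linarith)
  -- `‖∂ᵐF (c • y)‖ = o(‖c • y‖ᵖ)` and `‖c • y‖ᵖ = |c|ᵖ ‖y‖ᵖ`
  have h2 := hF.comp_tendsto (tendsto_dilation_cobounded c hc)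
  have h3 : (fun y : E3 ↦ ‖c • y‖ ^ p) =O[cobounded E3] fun y ↦ ‖y‖ ^ p := by
    refine IsBigO.of_bound (|c| ^ p) (Eventually.of_forall fun y ↦ ?_)
    have hy : ‖c • y‖ ^ p = |c| ^ p * ‖y‖ ^ p := by
      rw [norm_smul, Real.norm_eq_abs, Real.mul_rpow (abs_nonneg c) (norm_nonneg y)]
    rw [hy, Real.norm_of_nonneg (by positivity), Real.norm_of_nonneg (by positivity)]
  exact h1.trans_isLittleO (h2.trans_isBigO h3)

/-- **A constant multiple keeps the decay class** of a function smooth near infinity: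
`∂ᵐ(a • F) = a • ∂ᵐF` beyond the sphere where `F` is `C^m`. [folklore] -/
theorem isLittleO_iteratedFDeriv_const_smul {F : E3 → V} {R₀ p : ℝ} (a : ℝ) (m : ℕ)
    (hFs : ∀ y : E3, R₀ < ‖y‖ → ContDiffAt ℝ m F y)
    (hF : (fun y ↦ ‖iteratedFDeriv ℝ m F y‖) =o[cobounded E3] fun y ↦ ‖y‖ ^ p) :
    (fun y ↦ ‖iteratedFDeriv ℝ m (fun z ↦ a • F z) y‖) =o[cobounded E3] fun y ↦ ‖y‖ ^ p := by
  have h1 : (fun y ↦ ‖iteratedFDeriv ℝ m (fun z ↦ a • F z) y‖) =O[cobounded E3]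
      fun y ↦ ‖iteratedFDeriv ℝ m F y‖ := by
    refine IsBigO.of_bound |a| ?_
    filter_upwards [eventually_cobounded_le_norm (E := E3) (R₀ + 1)] with y hy
    rw [iteratedFDeriv_const_smul_apply' (hFs y (by linarith)), norm_smul,
      Real.norm_of_nonneg (mul_nonneg (norm_nonneg _) (norm_nonneg _)), Real.norm_of_nonneg (norm_nonneg _),
      Real.norm_eq_abs]
  exact h1.trans_isLittleO hF

end Dilation

/-! ### Transfer of the decay classes -/

namespace AFEnd

variable {X : Type*} [TopologicalSpace X] [ChartedSpace E3 X] [IsManifold (𝓡 3) ∞ X]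
  {X' : Type*} [TopologicalSpace X'] [ChartedSpace E3 X'] [IsManifold (𝓡 3) ∞ X']
  {e : AFEnd X} {e' : AFEnd X'} {D : InitialDataSet (𝓡 3) X} {D' : InitialDataSet (𝓡 3) X'}
  {c R₀ : ℝ}

/-- **The metric decay transfers under dilation of the chart, with mass `cM`**: if
`hCoeff e' D' ζ = hCoeff e D (c⁻¹ ζ)` beyond a sphere and `hCoeff e D − (1 + 2M/r)δ = o(r^{−β−m})`
at order `m`, then `hCoeff e' D' − (1 + 2(cM)/r)δ = o(r^{−β−m})` at order `m` (the latter function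
is the former composed with `ζ ↦ c⁻¹ ζ`, because `2(cM)/‖ζ‖ = 2M/‖c⁻¹ζ‖`).
[cite: DafermosRodnianski2013, App. B.2.3] -/
theorem isLittleO_hCoeff_of_dilation (hc : 0 < c)
    (hh : ∀ ζ : E3, R₀ < ‖ζ‖ → hCoeff e' D' ζ = hCoeff e D (c⁻¹ • ζ)) {M β : ℝ} {m : ℕ}
    (hD : (fun x ↦ ‖iteratedFDeriv ℝ m
        (fun y ↦ hCoeff e D y - (1 + 2 * M / ‖y‖) • (innerSL ℝ : E3 →L[ℝ] E3 →L[ℝ] ℝ)) x‖)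
      =o[cobounded E3] fun x ↦ ‖x‖ ^ (-β - m)) :
    (fun x ↦ ‖iteratedFDeriv ℝ m
        (fun y ↦ hCoeff e' D' y - (1 + 2 * (c * M) / ‖y‖) • (innerSL ℝ : E3 →L[ℝ] E3 →L[ℝ] ℝ)) x‖)
      =o[cobounded E3] fun x ↦ ‖x‖ ^ (-β - m) := by
  refine isLittleO_iteratedFDeriv_of_eqOn_dilation (c := c⁻¹) (R₀ := max R₀ 0) (inv_ne_zero hc.ne')
    (fun y hy ↦ ?_) m hD
  have hy0 : 0 < ‖y‖ := lt_of_le_of_lt (le_max_right _ _) hy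
  rw [hh y (lt_of_le_of_lt (le_max_left _ _) hy), norm_smul, norm_inv, Real.norm_of_nonneg hc.le]
  congr 2
  field_simp

/-- **The decay of `k` transfers under dilation of the chart**: if
`kCoeff e' D' ζ = c⁻¹ • kCoeff e D (c⁻¹ ζ)` beyond a sphere and `kCoeff e D = o(r^{−γ−m})` at order
`m`, then so is `kCoeff e' D'` (the constant `c⁻¹` commutes with `iteratedFDeriv` where
`kCoeff e D` is smooth, i.e. beyond `e.R`, `ContDiffOn_kCoeff_holds`). [cite: DafermosRodnianski2013, App. B.2.3] -/
theorem isLittleO_kCoeff_of_dilation (hc : 0 < c)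
    (hk : ∀ ζ : E3, R₀ < ‖ζ‖ → kCoeff e' D' ζ = c⁻¹ • kCoeff e D (c⁻¹ • ζ)) {γ : ℝ} {m : ℕ}
    (hD : (fun x ↦ ‖iteratedFDeriv ℝ m (kCoeff e D) x‖) =o[cobounded E3] fun x ↦ ‖x‖ ^ (-γ - m)) :
    (fun x ↦ ‖iteratedFDeriv ℝ m (kCoeff e' D') x‖) =o[cobounded E3] fun x ↦ ‖x‖ ^ (-γ - m) := by
  have hF : (fun x ↦ ‖iteratedFDeriv ℝ m (fun z ↦ c⁻¹ • kCoeff e D z) x‖) =o[cobounded E3]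
      fun x ↦ ‖x‖ ^ (-γ - m) := by
    refine isLittleO_iteratedFDeriv_const_smul (R₀ := e.R) c⁻¹ m (fun y hy ↦ ?_) hD
    exact ((ContDiffOn_kCoeff_holds e D).contDiffAt
      ((isOpen_lt continuous_const continuous_norm).mem_nhds hy)).of_le (by exact_mod_cast le_top)
  exact isLittleO_iteratedFDeriv_of_eqOn_dilation (F := fun z ↦ c⁻¹ • kCoeff e D z) (c := c⁻¹)
    (R₀ := R₀) (inv_ne_zero hc.ne') (fun y hy ↦ hk y hy) m hF

/-- **The decay classes transfer under dilation of the chart, with mass `cM`**: chart components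
related by `hCoeff e' D' = hCoeff e D ∘ (c⁻¹ •)`, `kCoeff e' D' = c⁻¹ • kCoeff e D ∘ (c⁻¹ •)` beyond a
sphere and `D` of class `(M, β, γ, nh, nk)` along `e` give `D'` of class `(cM, β, γ, nh, nk)`
along `e'` (Bartnik 1986, (4.2): the mass scales like a length). [cite: Bartnik1986, §1] -/
theorem IsStronglyAsymptoticallyFlatWith.of_coeff_dilation (hc : 0 < c)
    (hh : ∀ ζ : E3, R₀ < ‖ζ‖ → hCoeff e' D' ζ = hCoeff e D (c⁻¹ • ζ))
    (hk : ∀ ζ : E3, R₀ < ‖ζ‖ → kCoeff e' D' ζ = c⁻¹ • kCoeff e D (c⁻¹ • ζ))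
    {M β γ : ℝ} {nh nk : ℕ} (hD : e.IsStronglyAsymptoticallyFlatWith D M β γ nh nk) :
    e'.IsStronglyAsymptoticallyFlatWith D' (c * M) β γ nh nk :=
  ⟨fun m hm ↦ isLittleO_hCoeff_of_dilation hc hh (hD.1 m hm),
    fun m hm ↦ isLittleO_kCoeff_of_dilation hc hk (hD.2 m hm)⟩

/-- Dafermos–Rodnianski decay transfers under dilation of the chart, with mass `cM`.
[cite: DafermosRodnianski2013, App. B.2.3] -/
theorem IsStronglyAsymptoticallyFlatDR.of_coeff_dilation (hc : 0 < c)
    (hh : ∀ ζ : E3, R₀ < ‖ζ‖ → hCoeff e' D' ζ = hCoeff e D (c⁻¹ • ζ))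
    (hk : ∀ ζ : E3, R₀ < ‖ζ‖ → kCoeff e' D' ζ = c⁻¹ • kCoeff e D (c⁻¹ • ζ))
    {M : ℝ} (hD : e.IsStronglyAsymptoticallyFlatDR D M) :
    e'.IsStronglyAsymptoticallyFlatDR D' (c * M) :=
  IsStronglyAsymptoticallyFlatWith.of_coeff_dilation hc hh hk hD

end AFEnd

end Literature.Geometry.Lorentzian

end
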